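import Mathlib.Analysis.SpecialFunctions.Complex.Circle
import Mathlib.Analysis.Complex.Trigonometric
import Mathlib.Geometry.Manifold.Complex
import Mathlib.Data.Finset.NatAntidiagonal
import Mathlib.Analysis.Complex.Basic
import Mathlib.LinearAlgebra.Complex.Module
import Literature.NumberTheory.Transcendental.FormsAlgebra
import Literature.Geometry.Kaehler.ManifoldForms
import Literature.Geometry.Kaehler.Kaehler
import HarnessLib

-- provenance: harness21/H21/H21/Prelude/TranscendKaehlerL/ComplexForms.lean @ 4709b91 (interim HEAD d8f2665); M5 mechanical rewrite
/-!
# Complex-valued forms on a complex manifold: `(p,q)`-types and complex de Rham cohomology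

Trunk **T-KAEHLER** (G26 `TranscendKaehlerL`, item C9 `ComplexForms`; notions
`dolbeault_cohomology`, `de_rham_cohomology_manifold`).

Let `M` be a complex manifold modelled on the complex normed space `E` (charts valued in `E`;
we work with the underlying *real* model `𝓘(ℝ, E)`, so that a complex-valued `k`-form is an
`Literature.MForm 𝓘(ℝ, E) M ℂ k`, a `ℂ`-module through Mathlib's instance
`ContinuousAlternatingMap.instModule`). This file sets up:

* `Literature.tangentRotate E x θ`: the rotation `v ↦ e^{iθ} v` of the real tangent space, and its
  expression `cos θ • id + sin θ • J` through G21's `Literature.Geometry.Kaehler.tangentJ`;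
* the **type decomposition** of complex forms. A `k`-form `α` has *type `(p,q)`*
  (`Literature.IsOfType p q α`) if `p + q = k` and `α(e^{iθ}v₁,…,e^{iθ}v_k) = e^{i(p-q)θ} α(v₁,…,v_k)`
  for all `θ`; equivalently `α` is a section of `Λ^p T^{*1,0} ⊗ Λ^q T^{*0,1}`. Since
  `θ ↦ α(e^{iθ}v)` is a trigonometric polynomial of degree `≤ k`, the weight-`w` part of `α` is
  extracted by a *finite* Fourier average over the `(2k+1)`-st roots of unity
  (`Literature.Geometry.Kaehler.MForm.weightComponent`), which avoids any integration; `Literature.MForm.typeComponent p q α`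
  is the `(p,q)`-component `α^{p,q}`;
* complex conjugation `Literature.Geometry.Kaehler.MForm.conj` and complexification `Literature.Geometry.Kaehler.MForm.ofReal` of forms;
* the **complex de Rham complex with its `ℂ`-structure**: G21's `smoothForms`,
  `closedSmoothForms`, `exactSmoothForms`, `deRhamCohomology 𝓘(ℝ, E) M ℂ k` are only
  `ℝ`-modules, so we take the `ℂ`-spans of their carriers (`Literature.NumberTheory.Transcendental.csmoothForms`,
  `Literature.NumberTheory.Transcendental.cclosedSmoothForms`, `Literature.NumberTheory.Transcendental.cexactSmoothForms`; the carriers are already `ℂ`-stable, see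
  `Literature.NumberTheory.Transcendental.restrictScalars_csmoothForms`) and form `Literature.complexDeRhamCohomology E M k = Z^k_ℂ / B^k_ℂ`
  with its class map `Literature.NumberTheory.Transcendental.complexDeRhamCohomology.mk`;
* `Literature.hodgePQ E M k p q ⊆ H^k_dR(M; ℂ)`, the subspace of classes representable by closed forms of
  type `(p,q)`, and `Literature.pqForms E M p q`, the `ℂ`-module `A^{p,q}(M)` of smooth `(p,q)`-forms.

Mathlib has no differential forms on manifolds, no `(p,q)`-decomposition and no Dolbeault
theory at this pin (searched: `Dolbeault`, `pqType`, `typeDecomposition`, `deRham` — only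
`Mathlib.Analysis.Calculus.DifferentialForm.Basic` on normed spaces). Anchors used:
`Complex.exp`, `ContinuousLinearMap.restrictScalars`, `ContinuousAlternatingMap.compContinuousLinearMap`,
`ContinuousLinearMap.compContinuousAlternatingMap`, `Complex.conjCLE`, `Complex.ofRealCLM`,
`Finset.antidiagonal`, `Submodule.span`, `Submodule.restrictScalars`.

Design notes.
* All algebraic facts (idempotence/orthogonality of type components, the decomposition
  `α = ∑_{p+q=k} α^{p,q}`, additivity of types under wedge, swap under conjugation) are
  hypothesis-free. Smoothness of type components needs a **holomorphic atlas**: `inChart`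
  conjugates by derivatives of transition maps, which commute with `tangentRotate` only when they
  are `ℂ`-linear; hence `[IsManifold 𝓘(ℂ, E) ω M]` (and `[IsManifold 𝓘(ℝ, E) ∞ M]`, cf.
  `Literature.Geometry.Kaehler.isManifold_real_of_isManifold_complex`) on those statements.
* Conjugation on cohomology is *not* defined as a map (that would consume the sorried
  `Literature.NumberTheory.Transcendental.mextDeriv_conj`); `Literature.NumberTheory.Transcendental.conj_hodgePQ` is phrased on representing forms through the
  conjugate-linear map `Literature.Geometry.Kaehler.MForm.conjₛₗ`.

References: C. Voisin, *Hodge Theory and Complex Algebraic Geometry I* (2002), §2.3, §6.1;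
D. Huybrechts, *Complex Geometry* (2005), §1.3, §2.6; R. O. Wells, *Differential Analysis on
Complex Manifolds* (1980), Ch. I §3, Ch. II §1.
-/

noncomputable section

open scoped Manifold ContDiff Topology
open Bundle Set Finset

namespace Literature.NumberTheory.Transcendental

variable {E : Type*} [NormedAddCommGroup E] [NormedSpace ℂ E]
  {M : Type*} [TopologicalSpace M] [ChartedSpace E M] {k l : ℕ}

/-! ### Rotations of the real tangent space -/

variable (E) in
/-- Rotation by `e^{iθ}` on the real tangent space `T_x M = E` of a complex manifold:
`v ↦ e^{iθ} • v`, as a real continuous linear map. Voisin (2002), §2.3.1 (the `U(1)`-action whose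
weight spaces are the `(p,q)`-types); Huybrechts (2005), §1.3. [cite: Voisin2002] -/
def tangentRotate (x : M) (θ : ℝ) : TangentSpace 𝓘(ℝ, E) x →L[ℝ] TangentSpace 𝓘(ℝ, E) x :=
  ((Complex.exp (θ * Complex.I) • ContinuousLinearMap.id ℂ E).restrictScalars ℝ : E →L[ℝ] E)

/-- `tangentRotate E x θ v = e^{iθ} • v`, the scalar action being that of
`E = TangentSpace 𝓘(ℝ, E) x` (Voisin (2002), §2.3.1). Deliberately not `simp`: the right-hand
side lives in `E`, and rewriting with it breaks matching of lemmas stated on the tangent space. [cite: Voisin2002] -/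
theorem tangentRotate_apply (x : M) (θ : ℝ) (v : TangentSpace 𝓘(ℝ, E) x) :
    tangentRotate E x θ v = (letI V : E := v; Complex.exp (θ * Complex.I) • V) :=
  rfl

/-- `e^{iθ} = cos θ + sin θ · J` on the real tangent space (Voisin (2002), §2.3.1;
Huybrechts (2005), §1.3). [cite: Voisin2002] -/
theorem tangentRotate_eq_cos_add_sin_tangentJ (x : M) (θ : ℝ) (v : TangentSpace 𝓘(ℝ, E) x) :
    tangentRotate E x θ v = Real.cos θ • v + Real.sin θ • Literature.Geometry.Kaehler.tangentJ E x v := by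
  change (Complex.exp (θ * Complex.I) • (show E from v) : E) =
    (Real.cos θ • (show E from v) + Real.sin θ • (Complex.I • (show E from v)) : E)
  rw [Complex.exp_mul_I, ← Complex.ofReal_cos, ← Complex.ofReal_sin, add_smul, mul_smul,
    Complex.coe_smul, Complex.coe_smul]

/-- Rotation by angle `0` is the identity. [folklore] -/
@[simp]
theorem tangentRotate_zero_apply (x : M) (v : TangentSpace 𝓘(ℝ, E) x) :
    tangentRotate E x 0 v = v := by
  change (Complex.exp ((0 : ℝ) * Complex.I) • (show E from v) : E) = (show E from v)
  simp

/-! ### Weight and type components -/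

section MForm
open Literature.Geometry.Kaehler (MForm)
open Literature.Geometry.Kaehler.MForm

/-- The **weight-`w` component** of a complex `k`-form (`w = p - q` for type `(p,q)`), extracted
by the finite Fourier average over the `(2k+1)`-st roots of unity:
`α_w(x) = (2k+1)⁻¹ ∑_{j=0}^{2k} e^{-iwθⱼ} · (e^{iθⱼ})^* α(x)`, `θⱼ = 2πj/(2k+1)`.
Since `θ ↦ α(e^{iθ}v)` is a trigonometric polynomial with weights in `[-k, k]`, this equals the
usual `U(1)`-average. Voisin (2002), §2.3.1; Wells (1980), Ch. I §3. [cite: Voisin2002] -/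
def _root_.Literature.Geometry.Kaehler.MForm.weightComponent (w : ℤ) (α : MForm 𝓘(ℝ, E) M ℂ k) : MForm 𝓘(ℝ, E) M ℂ k :=
  fun x ↦ ((2 * k + 1 : ℕ) : ℂ)⁻¹ • ∑ j : Fin (2 * k + 1),
    Complex.exp (-(w * (2 * Real.pi * j / (2 * k + 1)) : ℝ) * Complex.I) •
      (α x).compContinuousLinearMap (tangentRotate E x (2 * Real.pi * j / (2 * k + 1)))

/-- The **`(p,q)`-component** `α^{p,q}` of a complex `k`-form: its weight-`(p-q)` component if
`p + q = k`, and `0` otherwise (a `k`-form has no `(p,q)`-part with `p + q ≠ k`).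
Voisin (2002), §2.3.1; Huybrechts (2005), §1.3; Wells (1980), Ch. I §3. [cite: Voisin2002] -/
def _root_.Literature.Geometry.Kaehler.MForm.typeComponent (p q : ℕ) (α : MForm 𝓘(ℝ, E) M ℂ k) : MForm 𝓘(ℝ, E) M ℂ k :=
  if p + q = k then α.weightComponent (p - q : ℤ) else 0

/-- Off the antidiagonal `p + q = k` the `(p,q)`-component of a `k`-form is `0` (by definition). [folklore] -/
theorem _root_.Literature.Geometry.Kaehler.MForm.typeComponent_of_ne {p q : ℕ} (h : p + q ≠ k) (α : MForm 𝓘(ℝ, E) M ℂ k) :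
    α.typeComponent p q = 0 := by
  simp [typeComponent, h]

/-- The weight components of the zero form vanish. [folklore] -/
@[simp]
theorem _root_.Literature.Geometry.Kaehler.MForm.weightComponent_zero (w : ℤ) : (0 : MForm 𝓘(ℝ, E) M ℂ k).weightComponent w = 0 := by
  funext x; ext v; simp [weightComponent]

/-- Weight components are additive. [folklore] -/
theorem _root_.Literature.Geometry.Kaehler.MForm.weightComponent_add (w : ℤ) (α β : MForm 𝓘(ℝ, E) M ℂ k) :
    (α + β).weightComponent w = α.weightComponent w + β.weightComponent w := by
  funext x; ext v
  simp [weightComponent, Finset.sum_add_distrib, mul_add, Finset.mul_sum]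

/-- Weight components are `ℂ`-linear. [folklore] -/
theorem _root_.Literature.Geometry.Kaehler.MForm.weightComponent_smul (w : ℤ) (c : ℂ) (α : MForm 𝓘(ℝ, E) M ℂ k) :
    (c • α).weightComponent w = c • α.weightComponent w := by
  funext x; ext v
  simp only [weightComponent, Pi.smul_apply, ContinuousAlternatingMap.smul_apply,
    ContinuousAlternatingMap.sum_apply, ContinuousAlternatingMap.compContinuousLinearMap_apply,
    smul_eq_mul, Finset.mul_sum]
  exact Finset.sum_congr rfl fun j _ ↦ by ring

/-- The `(p,q)`-component is additive (Voisin (2002), §2.3.1: the projections are linear). [cite: Voisin2002] -/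
theorem _root_.Literature.Geometry.Kaehler.MForm.typeComponent_add (p q : ℕ) (α β : MForm 𝓘(ℝ, E) M ℂ k) :
    (α + β).typeComponent p q = α.typeComponent p q + β.typeComponent p q := by
  unfold typeComponent
  split_ifs <;> simp [weightComponent_add]

/-- The `(p,q)`-component is `ℂ`-linear (Voisin (2002), §2.3.1). [cite: Voisin2002] -/
theorem _root_.Literature.Geometry.Kaehler.MForm.typeComponent_smul (p q : ℕ) (c : ℂ) (α : MForm 𝓘(ℝ, E) M ℂ k) :
    (c • α).typeComponent p q = c • α.typeComponent p q := by
  unfold typeComponent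
  split_ifs <;> simp [weightComponent_smul]

/-- The `(p,q)`-component of the zero form is zero. [folklore] -/
@[simp]
theorem _root_.Literature.Geometry.Kaehler.MForm.typeComponent_zero (p q : ℕ) : (0 : MForm 𝓘(ℝ, E) M ℂ k).typeComponent p q = 0 := by
  unfold typeComponent
  split_ifs <;> simp

end MForm

/-- A complex `k`-form has **type `(p,q)`** if `p + q = k` and it transforms with weight `p - q`
under the rotations `e^{iθ}` of the tangent space:
`α(e^{iθ}v₁, …, e^{iθ}v_k) = e^{i(p-q)θ} α(v₁, …, v_k)`. This is the pointwise condition of being a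
section of `Λ^{p,q} T^*M = Λ^p T^{*1,0} ⊗ Λ^q T^{*0,1}`. Voisin (2002), §2.3.1;
Huybrechts (2005), §1.3; Wells (1980), Ch. I §3. [cite: Voisin2002] -/
def IsOfType (p q : ℕ) (α : Literature.Geometry.Kaehler.MForm 𝓘(ℝ, E) M ℂ k) : Prop :=
  p + q = k ∧ ∀ (x : M) (θ : ℝ) (v : Fin k → TangentSpace 𝓘(ℝ, E) x),
    α x (fun i ↦ tangentRotate E x θ (v i)) =
      Complex.exp (((p : ℤ) - q : ℤ) * θ * Complex.I) * α x v

/-- A form of type `(p,q)` is a `(p+q)`-form. [folklore] -/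
theorem IsOfType.add_eq {p q : ℕ} {α : Literature.Geometry.Kaehler.MForm 𝓘(ℝ, E) M ℂ k} (h : IsOfType p q α) : p + q = k :=
  h.1

/-- The zero `k`-form has every type `(p,q)` with `p + q = k`. [folklore] -/
theorem isOfType_zero {p q : ℕ} (h : p + q = k) : IsOfType p q (0 : Literature.Geometry.Kaehler.MForm 𝓘(ℝ, E) M ℂ k) :=
  ⟨h, fun x θ v ↦ by simp⟩

/-- Forms of type `(p,q)` are stable under addition (Voisin (2002), §2.3.1). [cite: Voisin2002] -/
theorem IsOfType.add {p q : ℕ} {α β : Literature.Geometry.Kaehler.MForm 𝓘(ℝ, E) M ℂ k} (hα : IsOfType p q α)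
    (hβ : IsOfType p q β) : IsOfType p q (α + β) :=
  ⟨hα.1, fun x θ v ↦ by
    simp only [Pi.add_apply, ContinuousAlternatingMap.add_apply, hα.2 x θ v, hβ.2 x θ v, mul_add]⟩

/-- Forms of type `(p,q)` are stable under complex scalars (Voisin (2002), §2.3.1). [cite: Voisin2002] -/
theorem IsOfType.smul {p q : ℕ} (c : ℂ) {α : Literature.Geometry.Kaehler.MForm 𝓘(ℝ, E) M ℂ k} (hα : IsOfType p q α) :
    IsOfType p q (c • α) :=
  ⟨hα.1, fun x θ v ↦ by
    simp only [Pi.smul_apply, ContinuousAlternatingMap.smul_apply, hα.2 x θ v, smul_eq_mul]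
    ring⟩

/-- Forms of type `(p,q)` are stable under negation. [folklore] -/
theorem IsOfType.neg {p q : ℕ} {α : Literature.Geometry.Kaehler.MForm 𝓘(ℝ, E) M ℂ k} (hα : IsOfType p q α) :
    IsOfType p q (-α) := by
  simpa using hα.smul (-1)

/-- **Idempotence and orthogonality of the type projections**:
`(α^{p,q})^{p',q'} = α^{p,q}` if `(p,q) = (p',q')` and `0` otherwise.
Voisin (2002), §2.3.1; Wells (1980), Ch. I §3. [cite: Voisin2002] -/
def typeComponent_typeComponent : Prop :=
  ∀ (p q p' q' : ℕ) (α : Literature.Geometry.Kaehler.MForm 𝓘(ℝ, E) M ℂ k),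
    (α.typeComponent p q).typeComponent p' q' =
      if p = p' ∧ q = q' then α.typeComponent p q else 0

/-- The type projection is idempotent (Voisin (2002), §2.3.1). [cite: Voisin2002] -/
def typeComponent_typeComponent_self : Prop :=
  ∀ (p q : ℕ) (α : Literature.Geometry.Kaehler.MForm 𝓘(ℝ, E) M ℂ k),
    (α.typeComponent p q).typeComponent p q = α.typeComponent p q

/- interim proof relied on results that are now named facts (D-0014); demoted to a fact by the M5 import, proof preserved:
:= by
  simp [typeComponent_typeComponent]
-/

/-- **Type decomposition** of a complex `k`-form: `α = ∑_{p+q=k} α^{p,q}`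
(`Λ^k_ℂ = ⊕_{p+q=k} Λ^{p,q}` pointwise; no smoothness needed).
Voisin (2002), §2.3.1; Huybrechts (2005), §1.3; Wells (1980), Ch. I §3. [cite: Voisin2002] -/
def sum_antidiagonal_typeComponent : Prop :=
  ∀ (α : Literature.Geometry.Kaehler.MForm 𝓘(ℝ, E) M ℂ k),
    ∑ pq ∈ antidiagonal k, α.typeComponent pq.1 pq.2 = α

/-- The `(p,q)`-component of a `(p+q)`-form has type `(p,q)` (Voisin (2002), §2.3.1). [cite: Voisin2002] -/
def isOfType_typeComponent : Prop :=
  ∀ {p q : ℕ} (h : p + q = k) (α : Literature.Geometry.Kaehler.MForm 𝓘(ℝ, E) M ℂ k),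
    IsOfType p q (α.typeComponent p q)

/-- A `(p+q)`-form has type `(p,q)` iff it equals its `(p,q)`-component
(Voisin (2002), §2.3.1). [cite: Voisin2002] -/
def isOfType_iff_typeComponent_eq_self : Prop :=
  ∀ {p q : ℕ} (h : p + q = k) (α : Literature.Geometry.Kaehler.MForm 𝓘(ℝ, E) M ℂ k),
    IsOfType p q α ↔ α.typeComponent p q = α

/-- The other type components of a form of pure type `(p,q)` vanish.
[cite: VoisinHodgeI2002, §2.3.1] -/
def IsOfType.typeComponent_of_ne : Prop :=
  ∀ {p q p' q' : ℕ} {α : Literature.Geometry.Kaehler.MForm 𝓘(ℝ, E) M ℂ k} (hα : IsOfType p q α) (h : p ≠ p' ∨ q ≠ q'),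
    α.typeComponent p' q' = 0

/-- **Types add under the wedge product**: `A^{p,q} ∧ A^{p',q'} ⊆ A^{p+p',q+q'}`
(Voisin (2002), §2.3.1; Huybrechts (2005), §1.3). [cite: Voisin2002] -/
def IsOfType.wedge : Prop :=
  ∀ {p q p' q' : ℕ} {α : Literature.Geometry.Kaehler.MForm 𝓘(ℝ, E) M ℂ k} {β : Literature.Geometry.Kaehler.MForm 𝓘(ℝ, E) M ℂ l} (hα : IsOfType p q α) (hβ : IsOfType p' q' β),
    IsOfType (p + p') (q + q') (α.wedge β)

/-! ### Conjugation and complexification of forms -/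

section MForm
open Literature.Geometry.Kaehler (MForm)
open Literature.Geometry.Kaehler.MForm

/-- **Complex conjugate** of a complex form, `ᾱ(v) = conj (α(v))` (post-composition with the
real-linear `Complex.conjCLE`). Voisin (2002), §2.3.1; Wells (1980), Ch. I §3. [cite: Voisin2002] -/
def _root_.Literature.Geometry.Kaehler.MForm.conj (α : MForm 𝓘(ℝ, E) M ℂ k) : MForm 𝓘(ℝ, E) M ℂ k := fun x ↦
  (Complex.conjCLE : ℂ →L[ℝ] ℂ).compContinuousAlternatingMap (α x)

/-- Pointwise formula for the conjugate form (definitional). [folklore] -/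
@[simp]
theorem _root_.Literature.Geometry.Kaehler.MForm.conj_apply (α : MForm 𝓘(ℝ, E) M ℂ k) (x : M) (v : Fin k → TangentSpace 𝓘(ℝ, E) x) :
    α.conj x v = starRingEnd ℂ (α x v) :=
  rfl

/-- Conjugation of forms is an involution. [folklore] -/
@[simp]
theorem _root_.Literature.Geometry.Kaehler.MForm.conj_conj (α : MForm 𝓘(ℝ, E) M ℂ k) : α.conj.conj = α := by
  funext x; ext v; simp

/-- Conjugation of forms is additive. [folklore] -/
theorem _root_.Literature.Geometry.Kaehler.MForm.conj_add (α β : MForm 𝓘(ℝ, E) M ℂ k) : (α + β).conj = α.conj + β.conj := by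
  funext x; ext v; simp

/-- Conjugation of forms is conjugate-linear. [folklore] -/
theorem _root_.Literature.Geometry.Kaehler.MForm.conj_smul (c : ℂ) (α : MForm 𝓘(ℝ, E) M ℂ k) :
    (c • α).conj = starRingEnd ℂ c • α.conj := by
  funext x; ext v; simp

/-- Conjugation of complex `k`-forms as a conjugate-linear map (Voisin (2002), §2.3.1). [cite: Voisin2002] -/
def _root_.Literature.Geometry.Kaehler.MForm.conjₛₗ (k : ℕ) : MForm 𝓘(ℝ, E) M ℂ k →ₗ⋆[ℂ] MForm 𝓘(ℝ, E) M ℂ k where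
  toFun := conj
  map_add' := conj_add
  map_smul' := conj_smul

variable (E M) in
/-- `conjₛₗ` is `MForm.conj` (definitional). [folklore] -/
@[simp]
theorem _root_.Literature.Geometry.Kaehler.MForm.conjₛₗ_apply (α : MForm 𝓘(ℝ, E) M ℂ k) : conjₛₗ (E := E) (M := M) k α = α.conj :=
  rfl

/-- **Complexification** of a real form: `α ↦ α ⊗ 1`, post-composition with `ℝ ↪ ℂ`
(`Complex.ofRealCLM`). Voisin (2002), §2.3.1; Wells (1980), Ch. I §3. [cite: Voisin2002] -/
def _root_.Literature.Geometry.Kaehler.MForm.ofReal (α : MForm 𝓘(ℝ, E) M ℝ k) : MForm 𝓘(ℝ, E) M ℂ k := fun x ↦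
  Complex.ofRealCLM.compContinuousAlternatingMap (α x)

/-- Pointwise formula for the complexified form (definitional). [folklore] -/
@[simp]
theorem _root_.Literature.Geometry.Kaehler.MForm.ofReal_apply (α : MForm 𝓘(ℝ, E) M ℝ k) (x : M) (v : Fin k → TangentSpace 𝓘(ℝ, E) x) :
    α.ofReal x v = (α x v : ℂ) :=
  rfl

/-- Complexified real forms are real: `conj (α ⊗ 1) = α ⊗ 1`. [folklore] -/
@[simp]
theorem _root_.Literature.Geometry.Kaehler.MForm.conj_ofReal (α : MForm 𝓘(ℝ, E) M ℝ k) : α.ofReal.conj = α.ofReal := by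
  funext x; ext v; simp [Complex.conj_ofReal]

/-- Complexification is additive. [folklore] -/
theorem _root_.Literature.Geometry.Kaehler.MForm.ofReal_add (α β : MForm 𝓘(ℝ, E) M ℝ k) : (α + β).ofReal = α.ofReal + β.ofReal := by
  funext x; ext v; simp

/-- Complexification is `ℝ`-linear. [folklore] -/
theorem _root_.Literature.Geometry.Kaehler.MForm.ofReal_smul (c : ℝ) (α : MForm 𝓘(ℝ, E) M ℝ k) : (c • α).ofReal = (c : ℂ) • α.ofReal := by
  funext x; ext v; simp

end MForm

/-- **Conjugation swaps types**: if `α` has type `(p,q)` then `ᾱ` has type `(q,p)`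
(Voisin (2002), §2.3.1: `\overline{Λ^{p,q}} = Λ^{q,p}`). [cite: Voisin2002] -/
theorem IsOfType.conj {p q : ℕ} {α : Literature.Geometry.Kaehler.MForm 𝓘(ℝ, E) M ℂ k} (hα : IsOfType p q α) :
    IsOfType q p α.conj := by
  refine ⟨by rw [add_comm]; exact hα.1, fun x θ v ↦ ?_⟩
  rw [Literature.Geometry.Kaehler.MForm.conj_apply, Literature.Geometry.Kaehler.MForm.conj_apply, hα.2 x θ v, map_mul, ← Complex.exp_conj]
  congr 2
  simp only [map_mul, Complex.conj_ofReal, Complex.conj_I, ← Complex.ofReal_intCast,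
    Complex.conj_ofReal]
  push_cast
  ring

/-- The `(p,q)`-component of the conjugate is the conjugate of the `(q,p)`-component.
[cite: VoisinHodgeI2002, §2.3.1] -/
def typeComponent_conj : Prop :=
  ∀ (p q : ℕ) (α : Literature.Geometry.Kaehler.MForm 𝓘(ℝ, E) M ℂ k),
    α.conj.typeComponent p q = (α.typeComponent q p).conj

/-! ### Smoothness over `ℂ`: the complex de Rham complex -/

/-- The chart representative commutes with complex scalars. [folklore] -/
theorem _root_.Literature.Geometry.Kaehler.MForm.inChart_smul_complex (c : ℂ) (α : Literature.Geometry.Kaehler.MForm 𝓘(ℝ, E) M ℂ k) (x₀ : M) :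
    (c • α).inChart x₀ = c • α.inChart x₀ :=
  rfl

/-- Smooth complex forms are stable under complex scalars (the content of the `ℂ`-structure on
the de Rham complex; Wells (1980), Ch. II §1). [cite: Wells1980] -/
theorem _root_.Literature.Geometry.Kaehler.IsSmoothForm.smul_complex (c : ℂ) {α : Literature.Geometry.Kaehler.MForm 𝓘(ℝ, E) M ℂ k} (hα : Literature.Geometry.Kaehler.IsSmoothForm α) :
    Literature.Geometry.Kaehler.IsSmoothForm (c • α) := fun x ↦ by
  rw [Literature.Geometry.Kaehler.MForm.inChart_smul_complex]
  exact (hα x).const_smul c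

/-- The chart representative of the conjugate form is the conjugate of the representative. [folklore] -/
theorem _root_.Literature.Geometry.Kaehler.MForm.inChart_conj (α : Literature.Geometry.Kaehler.MForm 𝓘(ℝ, E) M ℂ k) (x₀ : M) :
    α.conj.inChart x₀ = fun y ↦ (Complex.conjCLE : ℂ →L[ℝ] ℂ).compContinuousAlternatingMap
      (α.inChart x₀ y) :=
  rfl

/-- The conjugate of a smooth form is smooth (hypothesis-free: conjugation is post-composition
with a real continuous linear map, which commutes with every chart change).
Wells (1980), Ch. I §3. [cite: Wells1980] -/
theorem isSmoothForm_conj {α : Literature.Geometry.Kaehler.MForm 𝓘(ℝ, E) M ℂ k} (hα : Literature.Geometry.Kaehler.IsSmoothForm α) :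
    Literature.Geometry.Kaehler.IsSmoothForm α.conj := fun x ↦ by
  rw [Literature.Geometry.Kaehler.MForm.inChart_conj]
  exact ((ContinuousLinearMap.compContinuousAlternatingMapCLM ℝ E ℂ ℂ (Fin k)
    (Complex.conjCLE : ℂ →L[ℝ] ℂ)).contDiff.of_le le_top).comp_contDiffWithinAt (hα x)

/-- The exterior derivative commutes with complex scalars (no smoothness needed: `range 𝓘(ℝ, E)`
has unique derivatives and `c • ·` is a real-linear automorphism for `c ≠ 0`).
Wells (1980), Ch. II §1. [cite: Wells1980] -/
def mextDeriv_smul_complex : Prop :=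
  ∀ (c : ℂ) (α : Literature.Geometry.Kaehler.MForm 𝓘(ℝ, E) M ℂ k),
    Literature.Geometry.Kaehler.mextDeriv (c • α) = c • Literature.Geometry.Kaehler.mextDeriv α

/-- The exterior derivative commutes with conjugation, `d ᾱ = \overline{dα}` (`d` is a real
operator). Wells (1980), Ch. I §3; Voisin (2002), §2.3.1. [cite: Wells1980] -/
def mextDeriv_conj : Prop :=
  ∀ (α : Literature.Geometry.Kaehler.MForm 𝓘(ℝ, E) M ℂ k),
    Literature.Geometry.Kaehler.mextDeriv α.conj = (Literature.Geometry.Kaehler.mextDeriv α).conj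

variable (E M) in
/-- The `ℂ`-module `A^k(M; ℂ)` of smooth complex `k`-forms: the `ℂ`-span of (the carrier of)
G21's `ℝ`-submodule `smoothForms 𝓘(ℝ, E) M ℂ k`; by `restrictScalars_csmoothForms` the span adds
nothing. Wells (1980), Ch. II §1; Voisin (2002), §2.3.1. [cite: Wells1980] -/
def csmoothForms (k : ℕ) : Submodule ℂ (Literature.Geometry.Kaehler.MForm 𝓘(ℝ, E) M ℂ k) :=
  Submodule.span ℂ (Literature.Geometry.Kaehler.smoothForms 𝓘(ℝ, E) M ℂ k : Set (Literature.Geometry.Kaehler.MForm 𝓘(ℝ, E) M ℂ k))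

variable (E M) in
/-- The `ℂ`-module `Z^k(M; ℂ)` of closed smooth complex `k`-forms: the `ℂ`-span of the carrier
of G21's `closedSmoothForms 𝓘(ℝ, E) M ℂ k`. Wells (1980), Ch. II §1; Bott–Tu (1982), §I.1. [cite: Wells1980] -/
def cclosedSmoothForms (k : ℕ) : Submodule ℂ (Literature.Geometry.Kaehler.MForm 𝓘(ℝ, E) M ℂ k) :=
  Submodule.span ℂ (Literature.Geometry.Kaehler.closedSmoothForms 𝓘(ℝ, E) M ℂ k : Set (Literature.Geometry.Kaehler.MForm 𝓘(ℝ, E) M ℂ k))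

variable (E M) in
/-- The `ℂ`-module `B^k(M; ℂ)` of exact smooth complex `k`-forms: `⊥` in degree `0` and the
`ℂ`-span of `d(A^k(M; ℂ))` in degree `k + 1` (pattern matching avoids `k - 1`).
Wells (1980), Ch. II §1; Bott–Tu (1982), §I.1. [cite: Wells1980] -/
def cexactSmoothForms : (k : ℕ) → Submodule ℂ (Literature.Geometry.Kaehler.MForm 𝓘(ℝ, E) M ℂ k)
  | 0 => ⊥
  | k + 1 => Submodule.span ℂ (Literature.Geometry.Kaehler.mextDeriv '' (csmoothForms E M k : Set (Literature.Geometry.Kaehler.MForm 𝓘(ℝ, E) M ℂ k)))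

/-- Smooth forms lie in `csmoothForms`. [folklore] -/
theorem mem_csmoothForms {α : Literature.Geometry.Kaehler.MForm 𝓘(ℝ, E) M ℂ k} (hα : Literature.Geometry.Kaehler.IsSmoothForm α) :
    α ∈ csmoothForms E M k :=
  Submodule.subset_span hα

/-- Closed smooth forms lie in `cclosedSmoothForms`. [folklore] -/
theorem mem_cclosedSmoothForms {α : Literature.Geometry.Kaehler.MForm 𝓘(ℝ, E) M ℂ k} (hα : Literature.Geometry.Kaehler.IsSmoothForm α)
    (hc : Literature.Geometry.Kaehler.IsClosedForm α) : α ∈ cclosedSmoothForms E M k :=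
  Submodule.subset_span ⟨hα, hc⟩

/-- The underlying `ℝ`-module of `csmoothForms` is G21's `smoothForms` (the carrier is
`ℂ`-stable by `IsSmoothForm.smul_complex`). [folklore] -/
theorem restrictScalars_csmoothForms (k : ℕ) :
    (csmoothForms E M k).restrictScalars ℝ = Literature.Geometry.Kaehler.smoothForms 𝓘(ℝ, E) M ℂ k := by
  let S : Submodule ℂ (Literature.Geometry.Kaehler.MForm 𝓘(ℝ, E) M ℂ k) :=
    { carrier := {α | Literature.Geometry.Kaehler.IsSmoothForm α}
      add_mem' := fun hα hβ ↦ hα.add hβ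
      zero_mem' := Literature.Geometry.Kaehler.isSmoothForm_zero
      smul_mem' := fun c _ hα ↦ hα.smul_complex c }
  have h : csmoothForms E M k = S := by
    refine le_antisymm (Submodule.span_le.mpr fun α hα ↦ hα) fun α hα ↦ ?_
    exact Submodule.subset_span hα
  ext α
  rw [Submodule.restrictScalars_mem, h]
  rfl

/-- Membership in `csmoothForms` is smoothness. [folklore] -/
@[simp]
theorem mem_csmoothForms_iff (α : Literature.Geometry.Kaehler.MForm 𝓘(ℝ, E) M ℂ k) :
    α ∈ csmoothForms E M k ↔ Literature.Geometry.Kaehler.IsSmoothForm α := by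
  rw [← Literature.Geometry.Kaehler.mem_smoothForms_iff, ← restrictScalars_csmoothForms k, Submodule.restrictScalars_mem]

/-- The underlying `ℝ`-module of `cclosedSmoothForms` is G21's `closedSmoothForms` (uses
`mextDeriv_smul_complex`). Wells (1980), Ch. II §1. [cite: Wells1980] -/
def restrictScalars_cclosedSmoothForms : Prop :=
  ∀ (k : ℕ),
    (cclosedSmoothForms E M k).restrictScalars ℝ = Literature.Geometry.Kaehler.closedSmoothForms 𝓘(ℝ, E) M ℂ k

/-- The underlying `ℝ`-module of `cexactSmoothForms` is G21's `exactSmoothForms`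
(uses `mextDeriv_smul_complex`). Wells (1980), Ch. II §1. [cite: Wells1980] -/
def restrictScalars_cexactSmoothForms : Prop :=
  ∀ (k : ℕ),
    (cexactSmoothForms E M k).restrictScalars ℝ = Literature.Geometry.Kaehler.exactSmoothForms 𝓘(ℝ, E) M ℂ k

/-- `d ∘ d = 0`: exact complex forms are closed (from G21's
`exactSmoothForms_le_closedSmoothForms`). Bott–Tu (1982), §I.1. [cite: BottTu1982] -/
def cexactSmoothForms_le_cclosedSmoothForms : Prop :=
  ∀ [IsManifold 𝓘(ℝ, E) ∞ M],
    cexactSmoothForms E M k ≤ cclosedSmoothForms E M k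

variable (E M) in
/-- **Complex de Rham cohomology** `H^k_dR(M; ℂ) = Z^k(M; ℂ) / B^k(M; ℂ)` with its `ℂ`-vector
space structure (G21's `deRhamCohomology 𝓘(ℝ, E) M ℂ k` is the same group as an `ℝ`-module
only). Wells (1980), Ch. II §1; Voisin (2002), §6.1. [cite: Wells1980] -/
def complexDeRhamCohomology (k : ℕ) : Type _ :=
  ↥(cclosedSmoothForms E M k) ⧸
    (cexactSmoothForms E M k).comap (cclosedSmoothForms E M k).subtype

namespace complexDeRhamCohomology

/-- The additive group structure on complex de Rham cohomology (the quotient structure, given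
explicitly because instance search through the type synonym is slow). [folklore] -/
instance instAddCommGroup : AddCommGroup (complexDeRhamCohomology E M k) :=
  Submodule.Quotient.addCommGroup _

/-- The `ℂ`-module structure on complex de Rham cohomology (the quotient structure). [folklore] -/
instance instModule : Module ℂ (complexDeRhamCohomology E M k) :=
  Submodule.Quotient.module _

variable (E M) in
/-- The cohomology class `[α] ∈ H^k_dR(M; ℂ)` of a closed smooth complex form
(Wells (1980), Ch. II §1). [cite: Wells1980] -/
def mk (k : ℕ) : cclosedSmoothForms E M k →ₗ[ℂ] complexDeRhamCohomology E M k :=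
  Submodule.mkQ _

/-- Every complex de Rham class is represented by a closed smooth complex form. [folklore] -/
theorem mk_surjective : Function.Surjective (mk E M k) :=
  Submodule.mkQ_surjective _

/-- Two closed forms define the same class iff their difference is exact
(Wells (1980), Ch. II §1). [cite: Wells1980] -/
theorem mk_eq_mk_iff (α β : cclosedSmoothForms E M k) :
    mk E M k α = mk E M k β ↔ (α : Literature.Geometry.Kaehler.MForm 𝓘(ℝ, E) M ℂ k) - β ∈ cexactSmoothForms E M k :=
  (Submodule.Quotient.eq _).trans Iff.rfl

end complexDeRhamCohomology

variable (E M) in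
/-- The subspace `H^{p,q} ⊆ H^k_dR(M; ℂ)` of classes representable by a closed form of type
`(p,q)` (the `ℂ`-span of such classes; `⊥` unless `p + q = k`, see `hodgePQ_eq_bot_of_ne`).
On a compact Kähler manifold these give the Hodge decomposition. Voisin (2002), §6.1;
Huybrechts (2005), §2.6 and Cor. 3.2.12. [cite: Voisin2002] -/
def hodgePQ (k p q : ℕ) : Submodule ℂ (complexDeRhamCohomology E M k) :=
  Submodule.span ℂ (complexDeRhamCohomology.mk E M k ''
    {α : cclosedSmoothForms E M k | IsOfType p q (α : Literature.Geometry.Kaehler.MForm 𝓘(ℝ, E) M ℂ k)})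

variable (E M) in
/-- The `ℂ`-module `A^{p,q}(M)` of smooth forms of type `(p,q)` (as `(p+q)`-forms; the span
adds nothing by `IsOfType.add/smul` and `IsSmoothForm.smul_complex`, see `mem_pqForms_iff`).
Voisin (2002), §2.3.1; Huybrechts (2005), §1.3; Wells (1980), Ch. I §3. [cite: Voisin2002] -/
def pqForms (p q : ℕ) : Submodule ℂ (Literature.Geometry.Kaehler.MForm 𝓘(ℝ, E) M ℂ (p + q)) :=
  Submodule.span ℂ {α | Literature.Geometry.Kaehler.IsSmoothForm α ∧ IsOfType p q α}

/-- Membership in `pqForms` is "smooth and of type `(p,q)`". [folklore] -/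
theorem mem_pqForms_iff {p q : ℕ} (α : Literature.Geometry.Kaehler.MForm 𝓘(ℝ, E) M ℂ (p + q)) :
    α ∈ pqForms E M p q ↔ Literature.Geometry.Kaehler.IsSmoothForm α ∧ IsOfType p q α := by
  let S : Submodule ℂ (Literature.Geometry.Kaehler.MForm 𝓘(ℝ, E) M ℂ (p + q)) :=
    { carrier := {α | Literature.Geometry.Kaehler.IsSmoothForm α ∧ IsOfType p q α}
      add_mem' := fun hα hβ ↦ ⟨hα.1.add hβ.1, hα.2.add hβ.2⟩
      zero_mem' := ⟨Literature.Geometry.Kaehler.isSmoothForm_zero, isOfType_zero rfl⟩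
      smul_mem' := fun c _ hα ↦ ⟨hα.1.smul_complex c, hα.2.smul c⟩ }
  have h : pqForms E M p q = S :=
    le_antisymm (Submodule.span_le.mpr fun α hα ↦ hα) fun α hα ↦ Submodule.subset_span hα
  rw [h]
  rfl

/-- `H^{p,q} = 0` inside `H^k_dR` unless `p + q = k` (there are no `k`-forms of type `(p,q)`). [folklore] -/
theorem hodgePQ_eq_bot_of_ne {p q : ℕ} (h : p + q ≠ k) : hodgePQ E M k p q = ⊥ := by
  rw [hodgePQ, Submodule.span_eq_bot]
  rintro _ ⟨α, hα, rfl⟩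
  exact absurd hα.1 h

/-! ### Statements needing a holomorphic atlas -/

section Holomorphic

variable [IsManifold 𝓘(ℂ, E) ω M] [IsManifold 𝓘(ℝ, E) ∞ M]

/-- On a complex manifold the type components of a smooth form are smooth (the transition maps
are holomorphic, so their derivatives commute with `tangentRotate`).
Voisin (2002), §2.3.1; Wells (1980), Ch. I §3. [cite: Voisin2002] -/
def isSmoothForm_typeComponent : Prop :=
  ∀ (p q : ℕ) {α : Literature.Geometry.Kaehler.MForm 𝓘(ℝ, E) M ℂ k} (hα : Literature.Geometry.Kaehler.IsSmoothForm α),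
    Literature.Geometry.Kaehler.IsSmoothForm (α.typeComponent p q)

-- Binder repair (2026-08-16): the header instance deliberately shadows the section's, which a
-- `def` does not capture (it ranged too widely before); the overlapping-instances linter is moot.
set_option linter.overlappingInstances false in
/-- On a complex manifold the weight components of a smooth form are smooth
(Voisin (2002), §2.3.1). [cite: Voisin2002]
(Binder repair 2026-08-16: `[IsManifold 𝓘(ℂ, E) ω M] [IsManifold 𝓘(ℝ, E) ∞ M]` is written in the
header so that it is a parameter of the elaborated constant; as a section instance unused by the
body it was silently dropped, so the fact ranged over cases the printed theorem excludes.) -/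
def isSmoothForm_weightComponent [IsManifold 𝓘(ℂ, E) ω M] [IsManifold 𝓘(ℝ, E) ∞ M] : Prop :=
  ∀ (w : ℤ) {α : Literature.Geometry.Kaehler.MForm 𝓘(ℝ, E) M ℂ k} (hα : Literature.Geometry.Kaehler.IsSmoothForm α),
    Literature.Geometry.Kaehler.IsSmoothForm (α.weightComponent w)

-- Binder repair (2026-08-16): the header instance deliberately shadows the section's, which a
-- `def` does not capture (it ranged too widely before); the overlapping-instances linter is moot.
set_option linter.overlappingInstances false in
/-- A smooth `(p+q)`-form decomposes inside `⨆ A^{p',q'}`: its `(p,q)`-component lies in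
`pqForms` (Voisin (2002), §2.3.1). [cite: Voisin2002]
(Binder repair 2026-08-16: `[IsManifold 𝓘(ℂ, E) ω M] [IsManifold 𝓘(ℝ, E) ∞ M]` is written in the
header so that it is a parameter of the elaborated constant; as a section instance unused by the
body it was silently dropped, so the fact ranged over cases the printed theorem excludes.) -/
def typeComponent_mem_pqForms [IsManifold 𝓘(ℂ, E) ω M] [IsManifold 𝓘(ℝ, E) ∞ M] : Prop :=
  ∀ {p q : ℕ} {α : Literature.Geometry.Kaehler.MForm 𝓘(ℝ, E) M ℂ (p + q)} (hα : Literature.Geometry.Kaehler.IsSmoothForm α),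
    α.typeComponent p q ∈ pqForms E M p q

/- interim proof relied on results that are now named facts (D-0014); demoted to a fact by the M5 import, proof preserved:
:=
  (mem_pqForms_iff _).mpr ⟨isSmoothForm_typeComponent p q hα, isOfType_typeComponent rfl α⟩
-/

/-- Conjugation preserves closed smooth complex forms (`d ᾱ = \overline{dα}`).
Wells (1980), Ch. II §1. [cite: Wells1980] -/
def conj_mem_cclosedSmoothForms : Prop :=
  ∀ {α : Literature.Geometry.Kaehler.MForm 𝓘(ℝ, E) M ℂ k} (hα : α ∈ cclosedSmoothForms E M k),
    α.conj ∈ cclosedSmoothForms E M k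

/-- Conjugation preserves exact smooth complex forms. Wells (1980), Ch. II §1. [cite: Wells1980] -/
def conj_mem_cexactSmoothForms : Prop :=
  ∀ {α : Literature.Geometry.Kaehler.MForm 𝓘(ℝ, E) M ℂ k} (hα : α ∈ cexactSmoothForms E M k),
    α.conj ∈ cexactSmoothForms E M k

/-- **Conjugation swaps `H^{p,q}` and `H^{q,p}`** (`\overline{H^{p,q}} = H^{q,p}`), phrased on
representatives: the closed forms representing classes in `H^{p,q}`, conjugated, are exactly the
closed forms representing classes in `H^{q,p}`. Voisin (2002), §6.1.1 (Hodge symmetry set-up);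
Huybrechts (2005), §2.6. [cite: Voisin2002] -/
def conj_hodgePQ : Prop :=
  ∀ (k p q : ℕ),
    (((hodgePQ E M k p q).comap (complexDeRhamCohomology.mk E M k)).map
        (cclosedSmoothForms E M k).subtype).map (Literature.Geometry.Kaehler.MForm.conjₛₗ k) =
      ((hodgePQ E M k q p).comap (complexDeRhamCohomology.mk E M k)).map
        (cclosedSmoothForms E M k).subtype

end Holomorphic

end Literature.NumberTheory.Transcendental
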